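import Mathlib

/-!
# Balaban 1985 (CMP 99:75), Lemma 1 (1.25) — the averaging step in the abelian (commuting) model

CITATION HEADER.
* [cite: Balaban1985RegularSpaces] T. Balaban, "Spaces of regular gauge field configurations on a
  lattice and gauge fixing conditions", Comm. Math. Phys. 99 (1985) 75–102; Lemma 1 (1.24)–(1.25) p. 79,
  proof p. 79–80.
* [cite: Balaban1985Averaging] T. Balaban, "Averaging operations for lattice gauge theories",
  Comm. Math. Phys. 98 (1985) 17–51; averaging (15), trees Γ_{c,x} (42), bounds (44)–(46) p. 24–25.

CONTEXT (adversarial reader, group A, gen 9). The proof of Lemma 1 (p. 79–80) bounds the perturbation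
`|V'_b − 1|` of a bond `b` crossing between two blocks `B(c₋)`, `B(c₊)` from the axial-gauge condition and the
smallness `|V̄'V₀ − V̄₀| < α₁` of the *averaged* bond variable.  The printed chain is
  interior bonds  < (d−1)(L−1)·P,   P = 2α₀L⁻²   (plaquette bound, (1.26));
  step between two neighbouring crossing bonds < P + 2·(d−1)(L−1)P < 4dα₀L⁻¹;
  ≤ (d−1)(L−1) steps ⇒ spread of crossing bonds < 4(d−1)dα₀;
  p. 79 last line – p. 80 line 2 (read from the PDF image; front of the sentence truncated, marked […]):
  «The condition […] ≦ α₁ implies |R(V₀([c₋,b₀₋]))V'_{b₀} − 1| ≦ 4(d−1)(L−1)Lα₀L⁻² + α₁ < 4(d−1)α₀ + α₁,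
  hence finally we have the bound (1.25) for an arbitrary bond b.»
The last displayed number accounts for the L−1 interior bonds of ONE segment but charges nothing for the passage
from the MEAN over the L^{d−1} crossing bonds of the block face to the single bond `b₀` (recorded as G-B8-10 in the
audit; the printed constant `4d²α₀ + α₁` of (1.25) survives with a corrected count, see below).

WHAT IS REPRODUCED (kernel-checked, no `sorry`).
1. `abs_sub_le_of_reach`: a chain of `n` adjacency steps, each moving a value by ≤ s, moves it by ≤ n·s
   (Balaban's step "≤ (d−1)(L−1) steps").
2. `abs_sub_mean_le`: if all pairwise differences of a finite family are ≤ D then every member is within D of the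
   mean (the passage mean → `b₀` that the printed proof omits).
3. `crossing_bound`: the abelian averaging step.  Crossing values `a t` (t = transverse position on the block face,
   `L^{d−1}` of them), interior contributions `e t h` of the `L` parallel segments through `t`, each `|e t h| ≤ (L−1)·I`;
   if the mean over all `|T|·L` segment values `a t + e t h` is `< α₁` in absolute value and crossing bonds are
   connected by ≤ N adjacency steps of size ≤ s, then `|a t| < α₁ + (L−1)·I + N·s`.
4. `coeff_eq`, `coeff_lt_printed`, `coeff_le`: with the printed numbers `P = 2α₀/L²`, `I = (d−1)(L−1)P`,
   `N = (d−1)(L−1)`, `s = P + 2I` the bound is `α₁ + coeff d L · α₀`,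
   `coeff d L = 2(d−1)(L−1)(1 + (2d−1)(L−1))/L² ≤ 2(d−1)(2d−1)(L−1)/L < 4d²`  (d ≥ 1, L ≥ 1),
   so the constant of (1.25) survives in the abelian model with slack `4d² − 2(d−1)(2d−1) = 6d − 2 ≥ 4`.
5. `lemma1_abelian`: the assembled statement `|a t| < 4d²α₀ + α₁`.
6. `printedChain_gt`: the printed chain COMPLETED at the omitted mean → `b₀` step by one more spread (charged from
   `b` to `b₀` and again from `b₀` to the mean) gives `(d−1)(8d+4)α₀ > 4d²α₀` for d ≥ 2. (The LITERAL printed chain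
   with its tail sums to `4(d−1)dα₀ + 4(d−1)α₀ + α₁ = 4(d²−1)α₀ + α₁ < 4d²α₀ + α₁`, i.e. it DOES reach (1.25);
   what fails is the unjustified passage mean → `b₀` — G-A14-1/G-B8-10 — and completing that step by the same
   spread mechanism overshoots, so a different count is needed: items 3–5.) And
   `b08_repair_le`: the earlier repair coefficient `(d−1)(4d+2+2/L) ≤ 4d² − d − 3` for L ≥ 2.

WHAT IS NOT REPRODUCED (leaves, stated honestly).
* The non-abelian remainders: (1.26)–(1.27) are proved in the paper via BCH ((38) of [Balaban1985Averaging],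
  `|𝔉(X;Y)| ≤ 24|X|²`), contributing O(α₀²) terms; the slack `6d − 2` absorbs them for α₀ small but this is not
  formalised.  The model here is linear/abelian: values add along paths and averages are arithmetic means.
* The lattice geometry: that the trees Γ_{c,x} of (42) contain ≤ (d−1)(L−1) bonds and that neighbouring crossing bonds
  are joined by ONE plaquette whose two remaining bonds are interior (steps 1–3 of the printed proof) enters as the
  hypotheses `N`, `s`, `I` of `crossing_bound`, not as a theorem about ℤ^d.
* Norms: `|·|` on the group is replaced by the absolute value on ℝ (Lie-algebra coordinates); for unitaries the
  telescoping `|UV − 1| ≤ |U − 1| + |V − 1|` used implicitly is not formalised.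
-/

namespace Literature.MathematicalPhysics.QuantumFieldTheory.Balaban1983to89.B8Lemma1Abelian

open Finset

/-- [folklore] Bounded-length reachability along an adjacency relation: `Reach adj n t v` = a chain of exactly `n`
adjacency steps from `t` to `v` (Balaban's "steps" between neighbouring crossing bonds, p. 79). -/
inductive Reach {T : Type*} (adj : T → T → Prop) : ℕ → T → T → Prop
  | refl (t : T) : Reach adj 0 t t
  | step {n : ℕ} {t u v : T} : adj t u → Reach adj n u v → Reach adj (n + 1) t v

/-- [cite: Balaban1985RegularSpaces, Lemma 1 proof step 4 p.79] Step 4 of the printed proof (p. 79): `n` steps of size ≤ `s` move the value by ≤ `n·s`. -/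
theorem abs_sub_le_of_reach {T : Type*} {adj : T → T → Prop} (a : T → ℝ) {s : ℝ}
    (hs : ∀ x y, adj x y → |a x - a y| ≤ s) :
    ∀ {n : ℕ} {t v : T}, Reach adj n t v → |a t - a v| ≤ n * s := by
  intro n t v h
  induction h with
  | refl t => simp
  | @step n t u v hadj _ ih =>
    have h1 := hs t u hadj
    calc |a t - a v| = |(a t - a u) + (a u - a v)| := by ring_nf
      _ ≤ |a t - a u| + |a u - a v| := abs_add_le _ _
      _ ≤ s + n * s := add_le_add h1 ih
      _ = ((n + 1 : ℕ) : ℝ) * s := by push_cast; ring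

/-- [folklore] The omitted passage (p. 79 last line): a member of a finite family whose pairwise differences are ≤ `D`
lies within `D` of the arithmetic mean. -/
theorem abs_sub_mean_le {T : Type*} [Fintype T] [Nonempty T] (a : T → ℝ) {D : ℝ}
    (hD : ∀ x y, |a x - a y| ≤ D) (t : T) :
    |a t - (∑ y, a y) / (Fintype.card T : ℝ)| ≤ D := by
  have hcard : (0 : ℝ) < Fintype.card T := by exact_mod_cast Fintype.card_pos
  have hrepr : a t - (∑ y, a y) / (Fintype.card T : ℝ)
      = (∑ y, (a t - a y)) / (Fintype.card T : ℝ) := by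
    rw [sum_sub_distrib, sum_const, card_univ, nsmul_eq_mul, sub_div]
    field_simp
  rw [hrepr, abs_div, abs_of_pos hcard, div_le_iff₀ hcard]
  calc |∑ y, (a t - a y)| ≤ ∑ y, |a t - a y| := abs_sum_le_sum_abs _ _
    _ ≤ ∑ _y : T, D := sum_le_sum fun y _ => hD t y
    _ = D * (Fintype.card T : ℝ) := by simp [mul_comm]

/-- [cite: Balaban1985RegularSpaces, Lemma 1 (1.25) p.79–80; abelian model] The abelian averaging step of Lemma 1.  `T` = the transverse positions of the crossing bonds of the block face
(`L^{d−1}` of them), `a t` = the (Lie-algebra) value of the crossing bond at `t`, `e t h` = the sum of the `L−1`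
interior bond values of the segment `[x, x(c)]` through `t` at longitudinal offset `h` (each interior bond ≤ `I`),
so the averaged bond variable of (15)/(43) [Balaban1985Averaging] is the mean of the `|T|·L` values `a t + e t h`. -/
theorem crossing_bound {T : Type*} [Fintype T] [Nonempty T] {L : ℕ} (hL : 0 < L)
    (a : T → ℝ) (e : T → Fin L → ℝ) {I s α₁ : ℝ} {N : ℕ}
    (adj : T → T → Prop)
    (he : ∀ t h, |e t h| ≤ ((L : ℝ) - 1) * I)
    (hmean : |(∑ t, ∑ h, (a t + e t h)) / ((Fintype.card T : ℝ) * L)| < α₁)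
    (hs : ∀ x y, adj x y → |a x - a y| ≤ s)
    (hN : ∀ x y, ∃ n, n ≤ N ∧ Reach adj n x y)
    (hs0 : 0 ≤ s) (t : T) :
    |a t| < α₁ + ((L : ℝ) - 1) * I + N * s := by
  set c : ℝ := (Fintype.card T : ℝ) with hc
  have hcpos : (0 : ℝ) < c := by rw [hc]; exact_mod_cast Fintype.card_pos
  have hLpos : (0 : ℝ) < L := by exact_mod_cast hL
  -- pairwise spread of the crossing values
  have hD : ∀ x y, |a x - a y| ≤ N * s := by
    intro x y
    obtain ⟨n, hn, hr⟩ := hN x y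
    calc |a x - a y| ≤ n * s := abs_sub_le_of_reach a hs hr
      _ ≤ N * s := by gcongr
  -- decomposition of the total mean
  have hsplit : (∑ t, ∑ h, (a t + e t h)) / (c * L)
      = (∑ t, a t) / c + (∑ t, ∑ h, e t h) / (c * L) := by
    have h1 : ∑ t, ∑ h : Fin L, (a t + e t h) = (∑ t, a t) * L + ∑ t, ∑ h, e t h := by
      simp only [sum_add_distrib, sum_const, card_univ, Fintype.card_fin, nsmul_eq_mul, sum_mul]
      ring
    rw [h1, add_div]
    congr 1
    field_simp
  -- the interior part of the mean is ≤ (L−1) I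
  have hint : |(∑ t, ∑ h, e t h) / (c * L)| ≤ ((L : ℝ) - 1) * I := by
    have hcL : (0 : ℝ) < c * L := mul_pos hcpos hLpos
    rw [abs_div, abs_of_pos hcL, div_le_iff₀ hcL]
    calc |∑ t, ∑ h, e t h| ≤ ∑ t, |∑ h, e t h| := abs_sum_le_sum_abs _ _
      _ ≤ ∑ t, ∑ h, |e t h| := sum_le_sum fun t _ => abs_sum_le_sum_abs _ _
      _ ≤ ∑ _t : T, ∑ _h : Fin L, ((L : ℝ) - 1) * I :=
          sum_le_sum fun t _ => sum_le_sum fun h _ => he t h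
      _ = ((L : ℝ) - 1) * I * (c * L) := by
          simp only [sum_const, card_univ, Fintype.card_fin, nsmul_eq_mul, hc]; ring
  -- the mean of the crossing values
  have hmeanA : |(∑ t, a t) / c| < α₁ + ((L : ℝ) - 1) * I := by
    have : (∑ t, a t) / c = (∑ t, ∑ h, (a t + e t h)) / (c * L) - (∑ t, ∑ h, e t h) / (c * L) := by
      rw [hsplit]; ring
    rw [this]
    calc |(∑ t, ∑ h, (a t + e t h)) / (c * L) - (∑ t, ∑ h, e t h) / (c * L)|
        ≤ |(∑ t, ∑ h, (a t + e t h)) / (c * L)| + |(∑ t, ∑ h, e t h) / (c * L)| := abs_sub _ _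
      _ < α₁ + ((L : ℝ) - 1) * I := add_lt_add_of_lt_of_le hmean hint
  -- from the mean to the single bond t
  have hdev := abs_sub_mean_le a hD t
  calc |a t| = |((∑ y, a y) / c) + (a t - (∑ y, a y) / c)| := by ring_nf
    _ ≤ |(∑ y, a y) / c| + |a t - (∑ y, a y) / c| := abs_add_le _ _
    _ < (α₁ + ((L : ℝ) - 1) * I) + N * s := add_lt_add_of_lt_of_le hmeanA hdev
    _ = α₁ + ((L : ℝ) - 1) * I + N * s := by ring

/-! ### The printed numbers -/

/-- [cite: Balaban1985RegularSpaces, (1.26) p.79] Plaquette bound (1.26): `P = 2α₀L⁻²`. -/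
noncomputable def P (α₀ L : ℝ) : ℝ := 2 * α₀ / L ^ 2

/-- [cite: Balaban1985RegularSpaces, Lemma 1 proof step 2 p.79] Interior-bond bound: `(d−1)(L−1)` tree bonds, each ≤ `P` (p. 79, step 2). -/
noncomputable def I (d L α₀ : ℝ) : ℝ := (d - 1) * (L - 1) * P α₀ L

/-- [cite: Balaban1985RegularSpaces, Lemma 1 proof step 4 p.79] Number of steps between two crossing bonds of the block face (p. 79, step 4). -/
noncomputable def N (d L : ℝ) : ℝ := (d - 1) * (L - 1)

/-- [cite: Balaban1985RegularSpaces, Lemma 1 proof step 3 p.79] Spread per step: one plaquette and two interior bonds (p. 79, step 3). -/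
noncomputable def s (d L α₀ : ℝ) : ℝ := P α₀ L + 2 * I d L α₀

/-- [cite: Balaban1985RegularSpaces, Lemma 1 (1.25) p.79; corrected count] The abelian coefficient of `α₀` in the corrected bound. -/
noncomputable def coeff (d L : ℝ) : ℝ := 2 * (d - 1) * (L - 1) * (1 + (2 * d - 1) * (L - 1)) / L ^ 2

/-- [cite: Balaban1985RegularSpaces, Lemma 1 proof p.79; abelian model] `(L−1)I + N s = coeff·α₀`. -/
theorem coeff_eq (d L α₀ : ℝ) (hL : L ≠ 0) :
    (L - 1) * I d L α₀ + N d L * s d L α₀ = coeff d L * α₀ := by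
  simp only [coeff, N, s, I, P]
  field_simp
  ring

/-- [folklore] `coeff d L ≤ 2(d−1)(2d−1)(L−1)/L` for `d ≥ 1`, `L ≥ 1`. -/
theorem coeff_le (d L : ℝ) (hd : 1 ≤ d) (hL : 1 ≤ L) :
    coeff d L ≤ 2 * (d - 1) * (2 * d - 1) * (L - 1) / L := by
  unfold coeff
  have hLpos : 0 < L := by linarith
  rw [div_le_div_iff₀ (by positivity) hLpos]
  have h1 : 0 ≤ 2 * (d - 1) * (L - 1) := by
    have := sub_nonneg.mpr hd; have := sub_nonneg.mpr hL; positivity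
  have h2 : 0 ≤ 2 * d - 2 := by linarith
  nlinarith [mul_nonneg h1 h2, mul_nonneg (mul_nonneg h1 h2) (sub_nonneg.mpr hL),
    mul_nonneg (mul_nonneg h1 h2) hLpos.le, mul_pos hLpos hLpos]

/-- [cite: Balaban1985RegularSpaces, (1.25) p.79] The corrected coefficient stays below the printed `4d²` of (1.25), with slack ≥ `6d − 2`. -/
theorem coeff_lt_printed (d L : ℝ) (hd : 1 ≤ d) (hL : 1 ≤ L) : coeff d L < 4 * d ^ 2 := by
  have hLpos : 0 < L := by linarith
  have h1 := coeff_le d L hd hL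
  have h2 : 2 * (d - 1) * (2 * d - 1) * (L - 1) / L ≤ 2 * (d - 1) * (2 * d - 1) := by
    rw [div_le_iff₀ hLpos]
    have : 0 ≤ 2 * (d - 1) * (2 * d - 1) := by
      have := sub_nonneg.mpr hd; nlinarith
    nlinarith
  nlinarith

/-- [cite: Balaban1985RegularSpaces, Lemma 1 (1.25) p.79; abelian model] Lemma 1 (1.25) in the abelian model with the printed inputs `P, I, N, s`: `|a t| < 4d²α₀ + α₁`. -/
theorem lemma1_abelian {T : Type*} [Fintype T] [Nonempty T] {L : ℕ} (hL : 0 < L) {d : ℕ} (hd : 1 ≤ d)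
    (a : T → ℝ) (e : T → Fin L → ℝ) {α₀ α₁ : ℝ} (hα₀ : 0 < α₀)
    (adj : T → T → Prop) {n : ℕ} (hn : (n : ℝ) = N d L)
    (he : ∀ t h, |e t h| ≤ ((L : ℝ) - 1) * I d L α₀)
    (hmean : |(∑ t, ∑ h, (a t + e t h)) / ((Fintype.card T : ℝ) * L)| < α₁)
    (hs : ∀ x y, adj x y → |a x - a y| ≤ s d L α₀)
    (hN : ∀ x y, ∃ m, m ≤ n ∧ Reach adj m x y) (t : T) :
    |a t| < 4 * (d : ℝ) ^ 2 * α₀ + α₁ := by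
  have hd' : (1 : ℝ) ≤ d := by exact_mod_cast hd
  have hL' : (1 : ℝ) ≤ L := by exact_mod_cast hL
  have hLpos : (0 : ℝ) < L := by linarith
  have hs0 : 0 ≤ s d L α₀ := by
    unfold s I P
    have := sub_nonneg.mpr hd'; have := sub_nonneg.mpr hL'
    positivity
  have h := crossing_bound hL a e adj he hmean hs hN hs0 t
  rw [hn, add_assoc, coeff_eq d L α₀ hLpos.ne'] at h
  have hc := coeff_lt_printed d L hd' hL'
  calc |a t| < α₁ + coeff d L * α₀ := h
    _ < α₁ + 4 * (d : ℝ) ^ 2 * α₀ := by gcongr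
    _ = 4 * (d : ℝ) ^ 2 * α₀ + α₁ := by ring

/-! ### The printed chain, taken literally, and the earlier repair -/

/-- [cite: Balaban1985RegularSpaces, p.79 l.−1 – p.80 l.1] Coefficient of `α₀` if the printed sentence (p. 79 l. −1 – p. 80 l. 1) is completed by charging the spread
`4d(d−1)` once more (mean → `b₀`), keeping the printed `4(d−1)` for the interior bonds:
`4d(d−1) + 4d(d−1) + 4(d−1) = (d−1)(8d+4)`. -/
def printedChain (d : ℝ) : ℝ := (d - 1) * (8 * d + 4)

/-- [cite: Balaban1985RegularSpaces, p.79 l.−1 – p.80 l.1] For `d ≥ 2` the chain completed at the omitted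
mean → `b₀` step by one more spread exceeds `4d²` (the literal printed chain reaches (1.25); the completed one
does not — see header item 6). -/
theorem printedChain_gt (d : ℝ) (hd : 2 ≤ d) : 4 * d ^ 2 < printedChain d := by
  unfold printedChain; nlinarith

/-- [folklore] The repair coefficient recorded with G-B8-10, `(d−1)(4d+2+2/L)`, is ≤ `4d² − d − 3` for `L ≥ 2`, `d ≥ 1`. -/
theorem b08_repair_le (d L : ℝ) (hd : 1 ≤ d) (hL : 2 ≤ L) :
    (d - 1) * (4 * d + 2 + 2 / L) ≤ 4 * d ^ 2 - d - 3 := by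
  have hLpos : 0 < L := by linarith
  have h2L : 2 / L ≤ 1 := by rw [div_le_iff₀ hLpos]; linarith
  have hd1 : 0 ≤ d - 1 := by linarith
  calc (d - 1) * (4 * d + 2 + 2 / L) ≤ (d - 1) * (4 * d + 3) := by
        apply mul_le_mul_of_nonneg_left _ hd1; linarith
    _ = 4 * d ^ 2 - d - 3 := by ring

/-- [folklore] The abelian coefficient is at most the earlier repair coefficient (for `d ≥ 1`, `L ≥ 1`). -/
theorem coeff_le_b08 (d L : ℝ) (hd : 1 ≤ d) (hL : 1 ≤ L) :
    coeff d L ≤ (d - 1) * (4 * d + 2 + 2 / L) := by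
  have hLpos : 0 < L := by linarith
  have h1 := coeff_le d L hd hL
  have hd1 : 0 ≤ d - 1 := by linarith
  have h2 : 2 * (d - 1) * (2 * d - 1) * (L - 1) / L ≤ (d - 1) * (4 * d + 2 + 2 / L) := by
    rw [div_le_iff₀ hLpos]
    have : (d - 1) * (4 * d + 2 + 2 / L) * L = (d - 1) * ((4 * d + 2) * L + 2) := by
      field_simp
    rw [this]
    nlinarith [mul_nonneg hd1 hLpos.le, mul_nonneg hd1 (sub_nonneg.mpr hd)]
  linarith

end Literature.MathematicalPhysics.QuantumFieldTheory.Balaban1983to89.B8Lemma1Abelian
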